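import Summits.QuantumFields.YangMills.Theorems.BalabanUVNodesN21CollarJunctionAtCubeLaw
import Summits.QuantumFields.YangMills.Theorems.BalabanUVNodesN21ShellSplitOfRecord13CoPHKeyed

/-!
# N21 (NE7c) · THE COLLAR JUNCTION AT THE RECORD's CUBE LAWS, KEYED: `ShellWeightBound` AT
# `crOfRecord₁₃At K₀ jcut (shellSplitOfRecord₁₃At N K₀ ρA ρB)` FROM BLOCK CHARTS AND (M1) ON THE IMAGE LAWS

R141 (C) seat pub-ymgap-dag-n21-e (g19), node N21 = NE7c (NOT PRINTED in [Bałaban 1983–89], NOT proved), strategy s3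
ALTERNATIVE CURRENCY, lane K3⁷ `SpineGivenEndpointR13SepCoPH` (stmt-QuantumFields-20544, `--kind proof --supports …
--as helper`).  Part 38s′ — sibling of 38s `…N21CollarJunctionAtCubeLaw` (400-line rule); consumes BY NAME dag-n21-d
g9's ★★★ `N21ShellSplitOfRecord13CoPH.shellWeightBound_crOfRecord₁₃At_shellSplit` (FILE 3 `…Keyed`) and 38s ★
`cubeAC_of_chart`.

WHAT THIS FILE PROVES (two theorems, 0 `def`, 0 `sorry`).  ★★ `shellWeightBound_crOfRecord₁₃At_shellSplit_of_charts`: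
dag-n21-d's N21 face at the spine reading of record WITH ITS SHELL SPLIT INHABITED, whose ONE displayed estimate is
`hM1A ∕ hM1B` (per run, per `(K, t, top cube a)`, the integral-form (M1) on the record's `a`-truncated dressed law),
with that estimate DISCHARGED from: one block frame `Y`; per-(run, K, t, a) measurable charts `ΦA ∕ ΦB` of the level
fields into `Y`; statistics `UA ∕ UB` on `Y` reading the cube's two (2.17) tests through the chart; and (M1)
`T4ShellMeasure.SlotAntiConcentration` ON THE IMAGE LAWS `(cubeLawOfDatum₉ …).map Φ` with constants `DA K ∕ DB K`,
`Σ_K D_K ρ_K < ∞` per run.  So N21 AT THE RECORD reads: (M1) for the record's truncated cube laws IN BLOCK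
COORDINATES — the shape the collar ENDs (38s ★★★) and the dilation ∕ centre ENDs (dag-n21-d parts 28 ∕ 31 ∕ 34,
dag-n21-w1 `…LowCentreEndSect1Letters` ∕ `…EndChartLetter`) conclude on their frames.  ★★ `…_of_charts_liveSel`:
the same on the live-selector line, where F3's (e1) integrability is a THEOREM (dag-n21-d FILE 3 §6).

BINDERS LEFT (displayed; other lanes' objects, none asserted): the charts and (M1) on their image laws (the (2.18)
fibre law in block coordinates = NODE O's term object), the reading clauses, (H-U), `0 ≤ ζ`, F3's (e1) integrability
(a THEOREM on the live-selector line: dag-n21-d FILE 3 §6), signs, summability of the level constants.  A6 said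
plainly: the zero width `ρ ≡ 0` with `D ≡ 0` is the junk instance (empty shells); content only at N16's closeness
widths — nothing inhabited here.

HONEST FRAMING.  [textbook] by-name composition; nothing of Bałaban's asserted; (M1) NOT PRINTED ∕ NOT proved; NE7c
NOT proved; N21 NOT discharged; K3⁷ NOT claimed; no `Provisos₁₃CoPH` inhabitant claimed (K0⁷ open); counts unmoved
(typed 28∕28 · discharged 5∕27); count-neutral; one finite 𝕋⁴ at fixed ε — nothing about ℝ⁴ ∕ OS ∕ mass gap ∕ Clay.
-/

set_option autoImplicit false

open MeasureTheory Set Function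
open scoped ENNReal BigOperators

namespace Summit.QuantumFields.YangMills.Theorems.N21CollarJunctionAtCubeLaw

open Literature.MathematicalPhysics.QuantumFieldTheory.Balaban1983to89
open Literature.MathematicalPhysics.QuantumFieldTheory.Balaban1983to89.T4Continuum
open Literature.MathematicalPhysics.QuantumFieldTheory.Balaban1983to89.Node00
open Literature.MathematicalPhysics.QuantumFieldTheory.Balaban1983to89.T4ShellMeasure (SlotAntiConcentration)
open Literature.MathematicalPhysics.QuantumFieldTheory.Balaban1983to89.T4IndicatorShell (ShellWeightBound)
open YMDAG.UVSplit (crOfRecord₁₃At runA₁₃ runB₁₃ histA₁₃ histB₁₃)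
open Summit.QuantumFields.YangMills.BalabanUVNodes.N19MGFFormAtRecord (wOfRecord₉_nonneg)
open Summit.QuantumFields.YangMills.Theorems.N21ShellSplitOfRecord13CoPH

/-! ## §1 At the keyed record: `ShellWeightBound` at `crOfRecord₁₃At … (shellSplitOfRecord₁₃At …)` from charts -/

section AtRecord

variable {F : T4Family} {N : ℕ} [NeZero N]

/-- **★★ N21's FACE AT THE SPINE READING OF RECORD FROM BLOCK CHARTS.**  dag-n21-d's ★★★
`shellWeightBound_crOfRecord₁₃At_shellSplit` with its ONE displayed estimate (`hM1A ∕ hM1B`: per run, per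
`(K, t, top cube a)`, (M1) on the record's `a`-truncated dressed law) DISCHARGED by 38s ★ `cubeAC_of_chart` from: one block frame `Y`,
per-(run, K, t, a) measurable charts `ΦA ∕ ΦB` of the level fields into `Y` with statistics `UA ∕ UB` reading the cube's
two tests, and (M1) ON THE IMAGE LAWS with constants `DA K ∕ DB K`, `Σ_K D_K ρ_K < ∞` per run.  Conclusion:
`ShellWeightBound` AT `crOfRecord₁₃At K₀ jcut (shellSplitOfRecord₁₃At N K₀ ρA ρB)` (its `l₀, T, A, B, shA, shB` and
canonical `Wsh`). [textbook] -/
theorem shellWeightBound_crOfRecord₁₃At_shellSplit_of_charts (K₀ : ℕ) (jcut : ℕ → ℕ) (ρA ρB : WidthLetter₁₃CoPH N)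
    (θ : Stage13HParams F N) (hP : θ.Provisos₁₃CoPH F N) (g₀ : ℕ → ℝ) (os : List (ULoop F))
    (hU : LocalBgMeasurable F N θ.ν) (hζ0 : ∀ p g k s Pl Ql RS U V', 0 ≤ θ.ζ p g k s Pl Ql RS U V')
    (hintA : ∀ (K : ℕ) (t : ℝ) (s : SeqOfRecord F θ.ν θ.τ9.M (histA₁₃ θ K₀ g₀ K) (K₀ + K) (K₀ + K)),
      Integrable (fun V => chiSeqOfRecord F N θ.ν θ.τ9.M (histA₁₃ θ K₀ g₀ K) (K₀ + K) (K₀ + K) s V *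
        dressedSlotsOfDatum₉ F N θ.toStage9Params (datumOfRecord₁₃CoPH F N θ hP) g₀ os t (runA₁₃ F K₀ g₀ K)
          (histA₁₃ θ K₀ g₀ K) (K₀ + K) s V)
        (fieldMeasure (F.P (K₀ + K)) (K₀ + K) (SU N)))
    (hintB : ∀ (K : ℕ) (t : ℝ) (s' : SeqOfRecord F θ.ν θ.τ9.M (histB₁₃ θ K₀ g₀ K) (K₀ + K + 1) (K₀ + K + 1)),
      Integrable (fun V => chiSeqOfRecord F N θ.ν θ.τ9.M (histB₁₃ θ K₀ g₀ K) (K₀ + K + 1) (K₀ + K + 1) s' V *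
        dressedSlotsOfDatum₉ F N θ.toStage9Params (datumOfRecord₁₃CoPH F N θ hP) g₀ os t (runB₁₃ F K₀ g₀ K)
          (histB₁₃ θ K₀ g₀ K) (K₀ + K + 1) s' V)
        (fieldMeasure (F.P (K₀ + K + 1)) (K₀ + K + 1) (SU N)))
    {DA DB : ℕ → ℝ} (hρA : ∀ K, 0 ≤ ρA F θ hP g₀ os K) (hDA : ∀ K, 0 ≤ DA K) (hρB : ∀ K, 0 ≤ ρB F θ hP g₀ os K)
    (hDB : ∀ K, 0 ≤ DB K)
    (hsA : Summable (fun K => DA K * ρA F θ hP g₀ os K)) (hsB : Summable (fun K => DB K * ρB F θ hP g₀ os K))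
    -- the block frame, the charts, their reading clauses and (M1) on the image laws
    {Y : Type*} [MeasurableSpace Y]
    (ΦA : ∀ (K : ℕ) (t : ℝ), ↥(cubeIndices (F.P (K₀ + K)) (cubeSide (F.P (K₀ + K)).L θ.ν.M₂
        (RkOfRecord (F.P (K₀ + K)).L θ.ν.r (histA₁₃ θ K₀ g₀ K (K₀ + K))) (K₀ + K))) →
      GaugeField (F.P (K₀ + K)) (K₀ + K) (SU N) → Y)
    (hΦA : ∀ K t a, Measurable (ΦA K t a))
    (UA : ∀ (K : ℕ) (t : ℝ), ↥(cubeIndices (F.P (K₀ + K)) (cubeSide (F.P (K₀ + K)).L θ.ν.M₂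
        (RkOfRecord (F.P (K₀ + K)).L θ.ν.r (histA₁₃ θ K₀ g₀ K (K₀ + K))) (K₀ + K))) → Y → ℝ)
    (huA : ∀ K t a V, UA K t a (ΦA K t a V) < epsOfRecord θ.ν (histA₁₃ θ K₀ g₀ K) (K₀ + K) ↔
      cubeChiAt F N θ.ν (histA₁₃ θ K₀ g₀ K) (K₀ + K) (K₀ + K) (epsOfRecord θ.ν (histA₁₃ θ K₀ g₀ K) (K₀ + K)) a V = 1)
    (huA' : ∀ K t a V, UA K t a (ΦA K t a V) < epsOfRecord θ.ν (histA₁₃ θ K₀ g₀ K) (K₀ + K) * (1 - ρA F θ hP g₀ os K) ↔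
      cubeChiAt F N θ.ν (histA₁₃ θ K₀ g₀ K) (K₀ + K) (K₀ + K)
        (epsOfRecord θ.ν (histA₁₃ θ K₀ g₀ K) (K₀ + K) * (1 - ρA F θ hP g₀ os K)) a V = 1)
    (hACA : ∀ (K : ℕ) (t : ℝ), |t| ≤ 1 → ∀ a,
      SlotAntiConcentration ((cubeLawOfDatum₉ F N θ.toStage9Params (datumOfRecord₁₃CoPH F N θ hP) g₀ os
        (runA₁₃ F K₀ g₀ K) (histA₁₃ θ K₀ g₀ K) (K₀ + K) t a).map (ΦA K t a)) (UA K t a)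
        (epsOfRecord θ.ν (histA₁₃ θ K₀ g₀ K) (K₀ + K)) (ρA F θ hP g₀ os K) (DA K))
    (ΦB : ∀ (K : ℕ) (t : ℝ), ↥(cubeIndices (F.P (K₀ + K + 1)) (cubeSide (F.P (K₀ + K + 1)).L θ.ν.M₂
        (RkOfRecord (F.P (K₀ + K + 1)).L θ.ν.r (histB₁₃ θ K₀ g₀ K (K₀ + K + 1))) (K₀ + K + 1))) →
      GaugeField (F.P (K₀ + K + 1)) (K₀ + K + 1) (SU N) → Y)
    (hΦB : ∀ K t a, Measurable (ΦB K t a))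
    (UB : ∀ (K : ℕ) (t : ℝ), ↥(cubeIndices (F.P (K₀ + K + 1)) (cubeSide (F.P (K₀ + K + 1)).L θ.ν.M₂
        (RkOfRecord (F.P (K₀ + K + 1)).L θ.ν.r (histB₁₃ θ K₀ g₀ K (K₀ + K + 1))) (K₀ + K + 1))) → Y → ℝ)
    (huB : ∀ K t a V, UB K t a (ΦB K t a V) < epsOfRecord θ.ν (histB₁₃ θ K₀ g₀ K) (K₀ + K + 1) ↔
      cubeChiAt F N θ.ν (histB₁₃ θ K₀ g₀ K) (K₀ + K + 1) (K₀ + K + 1)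
        (epsOfRecord θ.ν (histB₁₃ θ K₀ g₀ K) (K₀ + K + 1)) a V = 1)
    (huB' : ∀ K t a V,
      UB K t a (ΦB K t a V) < epsOfRecord θ.ν (histB₁₃ θ K₀ g₀ K) (K₀ + K + 1) * (1 - ρB F θ hP g₀ os K) ↔
      cubeChiAt F N θ.ν (histB₁₃ θ K₀ g₀ K) (K₀ + K + 1) (K₀ + K + 1)
        (epsOfRecord θ.ν (histB₁₃ θ K₀ g₀ K) (K₀ + K + 1) * (1 - ρB F θ hP g₀ os K)) a V = 1)
    (hACB : ∀ (K : ℕ) (t : ℝ), |t| ≤ 1 → ∀ a,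
      SlotAntiConcentration ((cubeLawOfDatum₉ F N θ.toStage9Params (datumOfRecord₁₃CoPH F N θ hP) g₀ os
        (runB₁₃ F K₀ g₀ K) (histB₁₃ θ K₀ g₀ K) (K₀ + K + 1) t a).map (ΦB K t a)) (UB K t a)
        (epsOfRecord θ.ν (histB₁₃ θ K₀ g₀ K) (K₀ + K + 1)) (ρB F θ hP g₀ os K) (DB K)) :
    ShellWeightBound (crOfRecord₁₃At K₀ jcut (shellSplitOfRecord₁₃At N K₀ ρA ρB) F θ hP g₀ os).l₀
      (crOfRecord₁₃At K₀ jcut (shellSplitOfRecord₁₃At N K₀ ρA ρB) F θ hP g₀ os).T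
      (crOfRecord₁₃At K₀ jcut (shellSplitOfRecord₁₃At N K₀ ρA ρB) F θ hP g₀ os).A
      (crOfRecord₁₃At K₀ jcut (shellSplitOfRecord₁₃At N K₀ ρA ρB) F θ hP g₀ os).B
      (crOfRecord₁₃At K₀ jcut (shellSplitOfRecord₁₃At N K₀ ρA ρB) F θ hP g₀ os).shA
      (crOfRecord₁₃At K₀ jcut (shellSplitOfRecord₁₃At N K₀ ρA ρB) F θ hP g₀ os).shB
      (crOfRecord₁₃At K₀ jcut (shellSplitOfRecord₁₃At N K₀ ρA ρB) F θ hP g₀ os).Wsh := by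
  -- the step weights of the tuple's Stage-9 part are nonnegative
  have hw0 : ∀ (p : B12.RunParams) (g : ℕ → ℝ) k s' U V', 0 ≤ wOfRecord₉ F N θ.toStage9Params p g k s' U V' :=
    fun p g => wOfRecord₉_nonneg θ.toStage9Params hζ0 p g
  refine shellWeightBound_crOfRecord₁₃At_shellSplit K₀ jcut ρA ρB θ hP g₀ os hU hζ0 hintA hintB hρA hDA hρB hDB
    hsA hsB ?_ ?_
  · intro K t ht a
    exact cubeAC_of_chart F N θ.toStage9Params (datumOfRecord₁₃CoPH F N θ hP) g₀ os (runA₁₃ F K₀ g₀ K)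
      (histA₁₃ θ K₀ g₀ K) (K₀ + K) hU (hw0 _ _) (hρA K) t a (hintA K t) (hΦA K t a) (UA K t a) (huA K t a)
      (huA' K t a) (hDA K) (hACA K t ht a)
  · intro K t ht a
    exact cubeAC_of_chart F N θ.toStage9Params (datumOfRecord₁₃CoPH F N θ hP) g₀ os (runB₁₃ F K₀ g₀ K)
      (histB₁₃ θ K₀ g₀ K) (K₀ + K + 1) hU (hw0 _ _) (hρB K) t a (hintB K t) (hΦB K t a) (UB K t a) (huB K t a)
      (huB' K t a) (hDB K) (hACB K t ht a)

/-- **★★ THE SAME ON THE LIVE-SELECTOR LINE** — F3's (e1) integrability row is a THEOREM there (dag-n21-d FILE 3 §6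
`integrable_topPieceA∕B_of_liveSel`: dag-n19-c's tower identity + dag-n19-d's (e1)); displayed rows = the live-selector
pin `hsel`, (H-U), (H-ζ), `0 ≤ ζ` (n20-d's extraction rows), the width letters' signs, the charts with their reading
clauses, and (M1) on the image laws with `Σ_K D_K ρ_K < ∞`. [textbook] -/
theorem shellWeightBound_crOfRecord₁₃At_shellSplit_of_charts_liveSel (K₀ : ℕ) (jcut : ℕ → ℕ)
    (ρA ρB : WidthLetter₁₃CoPH N) (θ : Stage13HParams F N) (hP : θ.Provisos₁₃CoPH F N) (g₀ : ℕ → ℝ)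
    (os : List (ULoop F)) (E : B12.RunParams → ℝ)
    (hsel : θ.ppSel = ppSelLiveOfRecord F N θ.ν θ.τ9 E (wOfRecord₉ F N θ.toStage9Params))
    (hU : LocalBgMeasurable F N θ.ν) (hζm : ZetaMeasurable F N θ.ζ)
    (hζ0 : ∀ p g k s Pl Ql RS U V', 0 ≤ θ.ζ p g k s Pl Ql RS U V')
    {DA DB : ℕ → ℝ} (hρA : ∀ K, 0 ≤ ρA F θ hP g₀ os K) (hDA : ∀ K, 0 ≤ DA K) (hρB : ∀ K, 0 ≤ ρB F θ hP g₀ os K)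
    (hDB : ∀ K, 0 ≤ DB K)
    (hsA : Summable (fun K => DA K * ρA F θ hP g₀ os K)) (hsB : Summable (fun K => DB K * ρB F θ hP g₀ os K))
    {Y : Type*} [MeasurableSpace Y]
    (ΦA : ∀ (K : ℕ) (t : ℝ), ↥(cubeIndices (F.P (K₀ + K)) (cubeSide (F.P (K₀ + K)).L θ.ν.M₂
        (RkOfRecord (F.P (K₀ + K)).L θ.ν.r (histA₁₃ θ K₀ g₀ K (K₀ + K))) (K₀ + K))) →
      GaugeField (F.P (K₀ + K)) (K₀ + K) (SU N) → Y)
    (hΦA : ∀ K t a, Measurable (ΦA K t a))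
    (UA : ∀ (K : ℕ) (t : ℝ), ↥(cubeIndices (F.P (K₀ + K)) (cubeSide (F.P (K₀ + K)).L θ.ν.M₂
        (RkOfRecord (F.P (K₀ + K)).L θ.ν.r (histA₁₃ θ K₀ g₀ K (K₀ + K))) (K₀ + K))) → Y → ℝ)
    (huA : ∀ K t a V, UA K t a (ΦA K t a V) < epsOfRecord θ.ν (histA₁₃ θ K₀ g₀ K) (K₀ + K) ↔
      cubeChiAt F N θ.ν (histA₁₃ θ K₀ g₀ K) (K₀ + K) (K₀ + K) (epsOfRecord θ.ν (histA₁₃ θ K₀ g₀ K) (K₀ + K)) a V = 1)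
    (huA' : ∀ K t a V, UA K t a (ΦA K t a V) < epsOfRecord θ.ν (histA₁₃ θ K₀ g₀ K) (K₀ + K) * (1 - ρA F θ hP g₀ os K) ↔
      cubeChiAt F N θ.ν (histA₁₃ θ K₀ g₀ K) (K₀ + K) (K₀ + K)
        (epsOfRecord θ.ν (histA₁₃ θ K₀ g₀ K) (K₀ + K) * (1 - ρA F θ hP g₀ os K)) a V = 1)
    (hACA : ∀ (K : ℕ) (t : ℝ), |t| ≤ 1 → ∀ a,
      SlotAntiConcentration ((cubeLawOfDatum₉ F N θ.toStage9Params (datumOfRecord₁₃CoPH F N θ hP) g₀ os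
        (runA₁₃ F K₀ g₀ K) (histA₁₃ θ K₀ g₀ K) (K₀ + K) t a).map (ΦA K t a)) (UA K t a)
        (epsOfRecord θ.ν (histA₁₃ θ K₀ g₀ K) (K₀ + K)) (ρA F θ hP g₀ os K) (DA K))
    (ΦB : ∀ (K : ℕ) (t : ℝ), ↥(cubeIndices (F.P (K₀ + K + 1)) (cubeSide (F.P (K₀ + K + 1)).L θ.ν.M₂
        (RkOfRecord (F.P (K₀ + K + 1)).L θ.ν.r (histB₁₃ θ K₀ g₀ K (K₀ + K + 1))) (K₀ + K + 1))) →
      GaugeField (F.P (K₀ + K + 1)) (K₀ + K + 1) (SU N) → Y)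
    (hΦB : ∀ K t a, Measurable (ΦB K t a))
    (UB : ∀ (K : ℕ) (t : ℝ), ↥(cubeIndices (F.P (K₀ + K + 1)) (cubeSide (F.P (K₀ + K + 1)).L θ.ν.M₂
        (RkOfRecord (F.P (K₀ + K + 1)).L θ.ν.r (histB₁₃ θ K₀ g₀ K (K₀ + K + 1))) (K₀ + K + 1))) → Y → ℝ)
    (huB : ∀ K t a V, UB K t a (ΦB K t a V) < epsOfRecord θ.ν (histB₁₃ θ K₀ g₀ K) (K₀ + K + 1) ↔
      cubeChiAt F N θ.ν (histB₁₃ θ K₀ g₀ K) (K₀ + K + 1) (K₀ + K + 1)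
        (epsOfRecord θ.ν (histB₁₃ θ K₀ g₀ K) (K₀ + K + 1)) a V = 1)
    (huB' : ∀ K t a V,
      UB K t a (ΦB K t a V) < epsOfRecord θ.ν (histB₁₃ θ K₀ g₀ K) (K₀ + K + 1) * (1 - ρB F θ hP g₀ os K) ↔
      cubeChiAt F N θ.ν (histB₁₃ θ K₀ g₀ K) (K₀ + K + 1) (K₀ + K + 1)
        (epsOfRecord θ.ν (histB₁₃ θ K₀ g₀ K) (K₀ + K + 1) * (1 - ρB F θ hP g₀ os K)) a V = 1)
    (hACB : ∀ (K : ℕ) (t : ℝ), |t| ≤ 1 → ∀ a,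
      SlotAntiConcentration ((cubeLawOfDatum₉ F N θ.toStage9Params (datumOfRecord₁₃CoPH F N θ hP) g₀ os
        (runB₁₃ F K₀ g₀ K) (histB₁₃ θ K₀ g₀ K) (K₀ + K + 1) t a).map (ΦB K t a)) (UB K t a)
        (epsOfRecord θ.ν (histB₁₃ θ K₀ g₀ K) (K₀ + K + 1)) (ρB F θ hP g₀ os K) (DB K)) :
    ShellWeightBound (crOfRecord₁₃At K₀ jcut (shellSplitOfRecord₁₃At N K₀ ρA ρB) F θ hP g₀ os).l₀
      (crOfRecord₁₃At K₀ jcut (shellSplitOfRecord₁₃At N K₀ ρA ρB) F θ hP g₀ os).T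
      (crOfRecord₁₃At K₀ jcut (shellSplitOfRecord₁₃At N K₀ ρA ρB) F θ hP g₀ os).A
      (crOfRecord₁₃At K₀ jcut (shellSplitOfRecord₁₃At N K₀ ρA ρB) F θ hP g₀ os).B
      (crOfRecord₁₃At K₀ jcut (shellSplitOfRecord₁₃At N K₀ ρA ρB) F θ hP g₀ os).shA
      (crOfRecord₁₃At K₀ jcut (shellSplitOfRecord₁₃At N K₀ ρA ρB) F θ hP g₀ os).shB
      (crOfRecord₁₃At K₀ jcut (shellSplitOfRecord₁₃At N K₀ ρA ρB) F θ hP g₀ os).Wsh :=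
  shellWeightBound_crOfRecord₁₃At_shellSplit_of_charts K₀ jcut ρA ρB θ hP g₀ os hU hζ0
    (fun K t s => integrable_topPieceA_of_liveSel K₀ θ hP E hsel hU hζm hζ0 g₀ os K t s)
    (fun K t s' => integrable_topPieceB_of_liveSel K₀ θ hP E hsel hU hζm hζ0 g₀ os K t s') hρA hDA hρB hDB hsA hsB
    ΦA hΦA UA huA huA' hACA ΦB hΦB UB huB huB' hACB

end AtRecord

end Summit.QuantumFields.YangMills.Theorems.N21CollarJunctionAtCubeLaw
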